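import Summits.BirchSwinnertonDyer.BirchSwinnertonDyer.Theorems.PrintCf2SplitBadTwoCMPrimaryLocalPinning
import Literature.NumberTheory.EllipticCurves.ZpExtensionInertiaTorsionCyclotomicProofs
import Literature.NumberTheory.GaloisRepresentations.LocalGaloisGroupFrobeniusProofs
import HarnessLib

/-!
# Crux `PrintCf2.SplitBadTwoRankOneOfFacts` (item stmt-BirchSwinnertonDyer-20368), road α over the CM field:
# LOCAL FIXED POINTS of the CM summands at the primes above `2` — the dyadic value `#H⁰(K_v, E[𝔮^∞]) ∈ {2, 4}`

Cell `bsd-print-cf2`, width seat `bsd-line-cf2-p1-w2` g8; `--supports stmt-BirchSwinnertonDyer-20368` (helper). HONEST FRAMING: nothing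
here closes a crux or a stub; BSD is not proved by any of this; no summit statement is proved by this seat. THEOREMS ONLY (no
definition, no named fact, no `sorry`). FILE 6 of the -w2 g8 pinning series (uses FILE 2 `…CMPrimaryLocalPinning`).

WHAT. `W/ℚ` elliptic with `j = −3375`, `K` a quadratic field with `θ² = −7`, `v ≠ v̄` the two places above `2`, `π ∈ End_K(E_K)` with
`π² = π − 2`, `ρ` EITHER `2`-adic root of `X² − X + 2`, `E[𝔮_ρ^∞] := (W.baseChange K).endEigenPrimaryTorsion 2 π ρ` (p646843; each summand
`≅ ℚ₂/ℤ₂`, levels `E[𝔮_ρ^∞][2^k]` cyclic of order `2^k`, p647665). For the local terms of road α's S3c₂ (control / leading term at the additive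
bottom, Agboola §6 and Prop. 8.1: `#W*(K_𝔭)`, `#W*(K_{𝔭*})`), the local torsion of the named module at the primes above `2` is PINNED BETWEEN
`ℤ/2` AND `ℤ/4`, whatever the local type of the summand:
* `smul_eq_self_of_two_nsmul_eq_zero` — every `g ∈ Γ_K` fixes `E[𝔮_ρ^∞][2]` (the scalar of an automorphism on a group of order `2` is odd);
* `four_nsmul_eq_zero_of_smul_eq` — an element acting as a `2`-adic scalar `t` with `t − 1 ∉ 8ℤ₂` has all fixed points in `E[𝔮_ρ^∞][4]`;
* **`exists_mem_decomp_four_nsmul_eq_zero_of_smul_eq`** — some `δ ∈ GreenbergSelmer.decomp v` has all its fixed points in `E[𝔮_ρ^∞][4]`: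
  in the unramified-twist case (FILE 2 (U)) a Frobenius `σ` (`exists_isFrobPow_holds`) acts as `±α` with `α − 1 ∉ 4ℤ₂` (`α(α − 1) = −2`),
  `α + 1 ∉ 8ℤ₂` (`(α + 1)(α − 2) = −4`); in the kernel-of-reduction case (FILE 2 (R)) an inertia element with `ε = 3`
  (`χ₂(I_𝔓) = ℤ₂ˣ` above a split prime, `ZpExtension.exists_mem_inertia_cyclotomicCharacter_eq_of_split`) acts as `±3`;
* **`natCard_eq_two_or_four_of_fixed`** — hence every subgroup `F ≤ E[𝔮_ρ^∞]` containing `E[𝔮_ρ^∞][2]` and fixed pointwise by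
  `GreenbergSelmer.decomp v` — `H⁰(K_v, E[𝔮_ρ^∞])`, and a fortiori `H⁰(K, E[𝔮_ρ^∞])` — has `#F ∈ {2, 4}`.
The EXACT value (`2` or `4`) depends on the sign of the quadratic twist on `D_v`, i.e. on the `2`-adic class `[d]₂` (e.g. `4` on the
kernel-type summand iff the twist sign correlates with `ε ≡ 3 (mod 4)` on inertia); the exported datum of p640618 carries anonymous signs, so
only the bound is proved here. beyond-print theorem: no.

References: K. Rubin, LNM 1716 (1999) §2, §3 (Lemma 3.6 (ii), Cor. 3.17), Prop. 5.4; A. Agboola, Compositio 143 (2007) §6, Prop. 8.1;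
[NeukirchANT1999] Ch. II (7.13).
-/

noncomputable section

open scoped Classical

set_option linter.dupNamespace false
set_option autoImplicit false

namespace Summit.BirchSwinnertonDyer.BirchSwinnertonDyer.Theorems.PrintCf2.CMPrimes

open WeierstrassCurve Literature.NumberTheory.EllipticCurves Literature.NumberTheory.GaloisRepresentations Field NumberField
  IsDedekindDomain

/-! ## §1 `2`-adic separations: `α ∓ 1`, `3 ∓ 1 ∉ 8ℤ₂` -/

section Padic

/-- `2 ∉ 8ℤ₂` and `4 ∉ 8ℤ₂` (norms). [folklore] -/
theorem two_pow_not_mem_span_eight {e : ℕ} (he : e < 3) :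
    ((2 : ℤ_[2]) ^ e) ∉ (Ideal.span {(2 : ℤ_[2]) ^ 3} : Ideal ℤ_[2]) := by
  intro h
  have hle := (PadicInt.norm_le_pow_iff_mem_span_pow _ _).mpr h
  have h2 : ‖(2 : ℤ_[2])‖ = ((2 : ℕ) : ℝ) ^ (-(1 : ℤ)) := by
    have := PadicInt.norm_p (p := 2)
    rw [show ((2 : ℕ) : ℤ_[2]) = 2 by norm_cast] at this
    rw [this, zpow_neg, zpow_one]
  rw [norm_pow, h2, ← zpow_natCast, ← zpow_mul] at hle
  have hlt : ((2 : ℕ) : ℝ) ^ (-(3 : ℕ) : ℤ) < ((2 : ℕ) : ℝ) ^ (-(1 : ℤ) * (e : ℕ)) :=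
    zpow_lt_zpow_right₀ (by norm_num) (by omega)
  exact absurd (lt_of_lt_of_le hlt hle) (lt_irrefl _)

/-- For a unit root `α` of `X² − X + 2`: `α − 1 ∉ 8ℤ₂` (`α(α − 1) = −2`) and `−α − 1 ∉ 8ℤ₂` (`(α + 1)(α − 2) = −4`). [folklore] -/
theorem unit_root_sub_one_not_mem_span_eight {α : ℤ_[2]ˣ} (hα : (α : ℤ_[2]) ^ 2 = (α : ℤ_[2]) - 2) (s : ℤ) (hs : s = 1 ∨ s = -1) :
    ((s : ℤ_[2]) * (α : ℤ_[2]) - 1) ∉ (Ideal.span {(2 : ℤ_[2]) ^ 3} : Ideal ℤ_[2]) := by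
  intro h
  rcases hs with rfl | rfl
  · -- `8 ∣ α − 1 ⟹ 8 ∣ α(α − 1) = −2`
    have h' : ((α : ℤ_[2]) - 1) ∈ (Ideal.span {(2 : ℤ_[2]) ^ 3} : Ideal ℤ_[2]) := by push_cast at h; rwa [one_mul] at h
    have h2 : ((2 : ℤ_[2]) ^ 1) ∈ (Ideal.span {(2 : ℤ_[2]) ^ 3} : Ideal ℤ_[2]) := by
      have := Ideal.mul_mem_left _ (-(α : ℤ_[2])) h'
      have e : -(α : ℤ_[2]) * ((α : ℤ_[2]) - 1) = (2 : ℤ_[2]) ^ 1 := by linear_combination (-1 : ℤ_[2]) * hα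
      rwa [e] at this
    exact two_pow_not_mem_span_eight (by norm_num) h2
  · -- `8 ∣ −α − 1 ⟹ 8 ∣ (α + 1)(α − 2) = −4`
    have h' : ((α : ℤ_[2]) + 1) ∈ (Ideal.span {(2 : ℤ_[2]) ^ 3} : Ideal ℤ_[2]) := by
      have := neg_mem h
      push_cast at this
      convert this using 1
      ring
    have h4 : ((2 : ℤ_[2]) ^ 2) ∈ (Ideal.span {(2 : ℤ_[2]) ^ 3} : Ideal ℤ_[2]) := by
      have := Ideal.mul_mem_left _ (2 - (α : ℤ_[2])) h'
      have e : (2 - (α : ℤ_[2])) * ((α : ℤ_[2]) + 1) = (2 : ℤ_[2]) ^ 2 := by linear_combination (-1 : ℤ_[2]) * hα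
      rwa [e] at this
    exact two_pow_not_mem_span_eight (by norm_num) h4

/-- `3 − 1 = 2 ∉ 8ℤ₂` and `−3 − 1 = −4 ∉ 8ℤ₂`. [folklore] -/
theorem three_sub_one_not_mem_span_eight (s : ℤ) (hs : s = 1 ∨ s = -1) :
    ((s : ℤ_[2]) * 3 - 1) ∉ (Ideal.span {(2 : ℤ_[2]) ^ 3} : Ideal ℤ_[2]) := by
  intro h
  rcases hs with rfl | rfl
  · have e : ((1 : ℤ) : ℤ_[2]) * 3 - 1 = (2 : ℤ_[2]) ^ 1 := by push_cast; ring
    exact two_pow_not_mem_span_eight (by norm_num) (e ▸ h)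
  · have e : (((-1 : ℤ) : ℤ_[2]) * 3 - 1) = -((2 : ℤ_[2]) ^ 2) := by push_cast; ring
    rw [e, Ideal.neg_mem_iff] at h
    exact two_pow_not_mem_span_eight (by norm_num) h

end Padic

/-! ## §2 Local fixed points of the CM summands at the primes above `2` -/

section Fixed

variable (W : WeierstrassCurve ℚ) [W.IsElliptic] (K : Type) [Field K] [NumberField K]

/-- **Every element of `Γ_K` fixes `E[𝔮_ρ^∞][2]`** (it acts on the cyclic group `E[𝔮_ρ^∞][2]` of order `2` by an integer scalar, which
must be odd since the action is by automorphisms). [cite: Rubin1999, §2 and Prop. 5.4] -/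
theorem smul_eq_self_of_two_nsmul_eq_zero (hj : W.j = -3375) {θ : K} (hθ : θ ^ 2 = -7)
    (π : (W.baseChange K).endRing) (hrel : (π : AddMonoid.End (W.baseChange K).geomPoints) * π = π - 2)
    {ρ : ℤ_[2]} (hρ : ρ * ρ = ρ - 2) (g : absoluteGaloisGroup K) :
    ∀ x ∈ (W.baseChange K).endEigenPrimaryTorsion 2 π ρ, 2 • x = 0 → g • x = x := by
  obtain ⟨-, -, -, -, -, -, hgen, hscal⟩ := endEigenPrimaryTorsion_two_structure W hj K hθ π hrel hρ
  obtain ⟨N, hN⟩ := hscal g 1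
  obtain ⟨g₁, hg₁M, hord, -⟩ := hgen 1
  simp only [pow_one] at hN hord
  have h2g : 2 • g₁ = 0 := by
    have := addOrderOf_nsmul_eq_zero g₁
    rwa [hord] at this
  -- `N` is odd
  have hodd : ¬ (2 : ℤ) ∣ N := by
    rintro ⟨m, rfl⟩
    have h0 : g • g₁ = 0 := by
      rw [hN g₁ hg₁M h2g, mul_comm, mul_zsmul, two_zsmul, ← two_nsmul, h2g, zsmul_zero]
    have : g₁ = 0 := by
      have := congrArg (g⁻¹ • ·) h0
      simpa only [inv_smul_smul, smul_zero] using this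
    rw [this, addOrderOf_zero] at hord
    exact absurd hord (by norm_num)
  intro x hx h2
  rw [hN x hx h2]
  obtain ⟨m, hm⟩ : ∃ m : ℤ, N = 2 * m + 1 := by
    rcases Int.even_or_odd N with ⟨m, hm⟩ | ⟨m, hm⟩
    · exact absurd ⟨m, by rw [hm]; ring⟩ hodd
    · exact ⟨m, hm⟩
  rw [hm, add_zsmul, one_zsmul, mul_comm, mul_zsmul, two_zsmul, ← two_nsmul, h2, zsmul_zero, zero_add]

/-- **An element acting as a scalar `t` with `t − 1 ∉ 8ℤ₂` has all its fixed points in `E[𝔮_ρ^∞][4]`.** [folklore] -/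
theorem four_nsmul_eq_zero_of_smul_eq (hj : W.j = -3375) {θ : K} (hθ : θ ^ 2 = -7)
    (π : (W.baseChange K).endRing) (hrel : (π : AddMonoid.End (W.baseChange K).geomPoints) * π = π - 2)
    {ρ : ℤ_[2]} (hρ : ρ * ρ = ρ - 2) (g : absoluteGaloisGroup K) {t : ℤ_[2]}
    (ht : (t - 1) ∉ (Ideal.span {(2 : ℤ_[2]) ^ 3} : Ideal ℤ_[2]))
    (h : ∀ (k : ℕ), ∀ x ∈ (W.baseChange K).endEigenPrimaryTorsion 2 π ρ, 2 ^ k • x = 0 →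
      ∀ N : ℤ, ((N : ℤ_[2]) - t) ∈ (Ideal.span {(2 : ℤ_[2]) ^ k} : Ideal ℤ_[2]) → g • x = N • x)
    {x : (W.baseChange K).geomPrimaryTorsion 2} (hx : x ∈ (W.baseChange K).endEigenPrimaryTorsion 2 π ρ) (hfix : g • x = x) :
    4 • x = 0 := by
  have _ := hj; have _ := hθ; have _ := hrel; have _ := hρ
  obtain ⟨m, hm⟩ : ∃ m : ℕ, 2 ^ m • x = 0 := by
    obtain ⟨m, hm⟩ := (AddCommGroup.mem_primaryComponent).mp x.2
    exact ⟨m, Subtype.ext (by rw [AddSubmonoidClass.coe_nsmul, ZeroMemClass.coe_zero]; exact hm)⟩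
  obtain ⟨j, -, hj'⟩ := (Nat.dvd_prime_pow Nat.prime_two).mp (addOrderOf_dvd_of_nsmul_eq_zero hm)
  have hxj : 2 ^ j • x = 0 := hj' ▸ addOrderOf_nsmul_eq_zero x
  by_cases hj3 : j ≤ 2
  · have : addOrderOf x ∣ 4 := by rw [hj', show (4 : ℕ) = 2 ^ 2 by norm_num]; exact pow_dvd_pow 2 hj3
    exact addOrderOf_dvd_iff_nsmul_eq_zero.mp this
  · exfalso
    obtain ⟨N, hN⟩ := exists_int_sub_mem_span (p := 2) t j
    have hgx : g • x = N • x := h j x hx hxj N hN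
    rw [hfix] at hgx
    have hdvd : (addOrderOf x : ℤ) ∣ (N - 1) :=
      addOrderOf_dvd_iff_zsmul_eq_zero.mpr (by rw [sub_smul, one_smul, ← hgx, sub_self])
    rw [hj'] at hdvd
    push_cast at hdvd
    have hmem := (intCast_mem_span_two_iff_dvd (N - 1) j).mpr hdvd
    have ht' : t - 1 ∈ (Ideal.span {(2 : ℤ_[2]) ^ j} : Ideal ℤ_[2]) := by
      have : t - 1 = ((N - 1 : ℤ) : ℤ_[2]) - ((N : ℤ_[2]) - t) := by push_cast; ring
      rw [this]
      exact Ideal.sub_mem _ hmem hN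
    exact ht (Ideal.span_singleton_le_span_singleton.mpr (pow_dvd_pow _ (by omega)) ht')

/-- **LOCAL FIXED POINTS AT THE PRIMES ABOVE `2` LIE IN `E[𝔮_ρ^∞][4]`.** `W/ℚ` elliptic, `j = −3375`, `[K:ℚ] = 2` with `θ² = −7`,
`v ≠ v̄` the two places above `2`, `π² = π − 2`, `ρ² = ρ − 2` (EITHER root, EITHER local type): some element `δ` of the decomposition
group `GreenbergSelmer.decomp v` has all its fixed points on `E[𝔮_ρ^∞]` inside `E[𝔮_ρ^∞][4]` — a Frobenius acting as `±α` with
`α − 1 ∉ 4ℤ₂`, `α + 1 ∉ 8ℤ₂` in the unramified-twist case, an inertia element with `ε = 3` acting as `±3` in the kernel-of-reduction case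
(`χ₂(I_𝔓) = ℤ₂ˣ` above a split prime, `exists_mem_inertia_cyclotomicCharacter_eq_of_split`). Hence `H⁰(K_v, E[𝔮_ρ^∞]) ⊆ E[𝔮_ρ^∞][4]`.
[cite: Rubin1999, §3 Lemma 3.6 (ii) and Cor. 3.17] [cite: NeukirchANT1999, Ch. II (7.13)] -/
theorem exists_mem_decomp_four_nsmul_eq_zero_of_smul_eq (hj : W.j = -3375) (hK2 : Module.finrank ℚ K = 2) {θ : K}
    (hθ : θ ^ 2 = -7) (π : (W.baseChange K).endRing) (hrel : (π : AddMonoid.End (W.baseChange K).geomPoints) * π = π - 2)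
    {ρ : ℤ_[2]} (hρ : ρ * ρ = ρ - 2) {v vbar : HeightOneSpectrum (𝓞 K)}
    (hv : ((2 : ℕ) : 𝓞 K) ∈ v.asIdeal) (hvbar : ((2 : ℕ) : 𝓞 K) ∈ vbar.asIdeal) (hne : vbar ≠ v) :
    ∃ δ ∈ GreenbergSelmer.decomp v, ∀ x ∈ (W.baseChange K).endEigenPrimaryTorsion 2 π ρ, δ • x = x → 4 • x = 0 := by
  haveI : Fact (Nat.Prime 2) := ⟨Nat.prime_two⟩
  obtain ⟨ρ₁, ρ₂, α, hρρ, hα, -, hU, hR, -⟩ :=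
    endEigenPrimaryTorsion_two_localTypes W K hj hθ π hrel hρ v hv (inertiaDeg_eq_one_of_ne_two K hK2 hv hvbar hne)
  have hα' : (α : ℤ_[2]) ^ 2 = (α : ℤ_[2]) - 2 := hα
  rcases hρρ with ⟨rfl, -⟩ | ⟨-, rfl⟩
  · -- unramified-twist type: a Frobenius
    obtain ⟨σ, hσ⟩ := exists_isFrobPow_holds (F := v.adicCompletion K) 1
    obtain ⟨s, hs, h⟩ := hU σ 1 (by exact_mod_cast hσ)
    simp only [pow_one] at h
    refine ⟨absGaloisRestrict K (v.adicCompletion K) σ, ⟨σ, rfl⟩, fun x hx hfix ↦ ?_⟩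
    exact four_nsmul_eq_zero_of_smul_eq W K hj hθ π hrel hρ _ (unit_root_sub_one_not_mem_span_eight hα' s hs) h hx hfix
  · -- kernel-of-reduction type: an inertia element with `ε = 3`
    have hu3 : IsUnit ((3 : ℤ) : ℤ_[2]) := by
      rw [PadicInt.isUnit_iff]
      refine le_antisymm (PadicInt.norm_le_one _) (not_lt.mp fun hlt ↦ ?_)
      have h3 : (2 : ℤ) ∣ 3 := by exact_mod_cast (PadicInt.norm_int_lt_one_iff_dvd (p := 2) 3).mp hlt
      omega
    obtain ⟨τ, hτI, hτχ⟩ := ZpExtension.exists_mem_inertia_cyclotomicCharacter_eq_of_split hK2 hvbar hv hne.symm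
      (adicCompletionPrime_mem_primesAbove K v) hu3.unit
    rw [inertia_adicCompletionPrime_eq_map_absInertia K v, Subgroup.mem_map] at hτI
    obtain ⟨σ, hσI, hστ⟩ := hτI
    have hτχ' : GaloisRep.cyclotomicCharacter K 2 (absGaloisRestrict K (v.adicCompletion K) σ) = hu3.unit := by
      rw [← hτχ]; exact congrArg _ hστ
    obtain ⟨s, hs, h⟩ := hR σ 0 (by exact_mod_cast (isFrobPow_zero_iff_mem_absInertia.mpr hσI))
    simp only [pow_zero, mul_one, hτχ', IsUnit.unit_spec, Int.cast_ofNat] at h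
    refine ⟨absGaloisRestrict K (v.adicCompletion K) σ, ⟨σ, rfl⟩, fun x hx hfix ↦ ?_⟩
    exact four_nsmul_eq_zero_of_smul_eq W K hj hθ π hrel hρ _ (three_sub_one_not_mem_span_eight s hs) h hx hfix

/-- **`#H⁰(K_v, E[𝔮_ρ^∞]) ∈ {2, 4}`** — the dyadic value. In the same setting, every subgroup `F ≤ E[𝔮_ρ^∞]` containing `E[𝔮_ρ^∞][2]` and fixed
pointwise by `GreenbergSelmer.decomp v` (e.g. `H⁰(K_v, W*)`, `H⁰(K, W*)`) has `#F = 2` or `#F = 4`: `E[𝔮_ρ^∞][2] ≤ F ≤ E[𝔮_ρ^∞][4]`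
(`smul_eq_self_of_two_nsmul_eq_zero`, `exists_mem_decomp_four_nsmul_eq_zero_of_smul_eq`) and the levels have orders `2`, `4`.
[cite: Rubin1999, §2 and Prop. 5.4] [cite: Agboola2007, §6 and Prop. 8.1] -/
theorem natCard_eq_two_or_four_of_fixed (hj : W.j = -3375) (hK2 : Module.finrank ℚ K = 2) {θ : K} (hθ : θ ^ 2 = -7)
    (π : (W.baseChange K).endRing) (hrel : (π : AddMonoid.End (W.baseChange K).geomPoints) * π = π - 2)
    {ρ : ℤ_[2]} (hρ : ρ * ρ = ρ - 2) {v vbar : HeightOneSpectrum (𝓞 K)}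
    (hv : ((2 : ℕ) : 𝓞 K) ∈ v.asIdeal) (hvbar : ((2 : ℕ) : 𝓞 K) ∈ vbar.asIdeal) (hne : vbar ≠ v)
    (F : AddSubgroup ((W.baseChange K).geomPrimaryTorsion 2)) (hF : F ≤ (W.baseChange K).endEigenPrimaryTorsion 2 π ρ)
    (h2 : ∀ x ∈ (W.baseChange K).endEigenPrimaryTorsion 2 π ρ, 2 • x = 0 → x ∈ F)
    (hfix : ∀ δ ∈ GreenbergSelmer.decomp v, ∀ x ∈ F, δ • x = x) : Nat.card F = 2 ∨ Nat.card F = 4 := by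
  obtain ⟨-, -, -, -, -, hcard, -, -⟩ := endEigenPrimaryTorsion_two_structure W hj K hθ π hrel hρ
  obtain ⟨δ, hδ, h4⟩ := exists_mem_decomp_four_nsmul_eq_zero_of_smul_eq W K hj hK2 hθ π hrel hρ hv hvbar hne
  set M := (W.baseChange K).endEigenPrimaryTorsion 2 π ρ
  have hle4 : F ≤ M ⊓ AddSubgroup.torsionBy _ (2 ^ 2 : ℕ) := fun x hx ↦
    ⟨hF hx, AddSubgroup.torsionBy.nsmul_iff.mpr (by rw [show (2 ^ 2 : ℕ) = 4 by norm_num]; exact h4 x (hF hx) (hfix δ hδ x hx))⟩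
  have hge2 : M ⊓ AddSubgroup.torsionBy _ (2 ^ 1 : ℕ) ≤ F := fun x hx ↦ by
    refine h2 x hx.1 ?_
    have := AddSubgroup.torsionBy.nsmul_iff.mp hx.2
    rwa [pow_one] at this
  haveI : Finite ↥(M ⊓ AddSubgroup.torsionBy _ (2 ^ 2 : ℕ)) := Nat.finite_of_card_ne_zero (by rw [hcard 2]; norm_num)
  have hdvd4 : Nat.card F ∣ 2 ^ 2 := hcard 2 ▸ AddSubgroup.card_dvd_of_le hle4
  haveI : Finite F := Finite.of_injective _ (AddSubgroup.inclusion_injective hle4)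
  have hdvd2 : 2 ^ 1 ∣ Nat.card F := hcard 1 ▸ AddSubgroup.card_dvd_of_le hge2
  obtain ⟨i, hi, hFi⟩ := (Nat.dvd_prime_pow Nat.prime_two).mp hdvd4
  rw [hFi] at hdvd2 ⊢
  have hi1 : 1 ≤ i := (Nat.pow_dvd_pow_iff_le_right (by norm_num)).mp hdvd2
  interval_cases i
  · exact Or.inl rfl
  · exact Or.inr rfl

end Fixed

end Summit.BirchSwinnertonDyer.BirchSwinnertonDyer.Theorems.PrintCf2.CMPrimes

end
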